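import Summits.BirchSwinnertonDyer.Rank1Residual.Additive.FormalGroupBallPoints
import Literature.NumberTheory.EllipticCurves.FormalGroupLawChordFormulaProofs
import Literature.NumberTheory.EllipticCurves.FormalGroupLaurentPoints
import HarnessLib

/-!
# The formal group law computes `E₁(K)` for `K ⊇ ℚ_p` complete, I: evaluation of the chord and
# doubling identities at a pair of parameters, and the chord case `P(u) + P(v) = P(F(u, v))` for
# `x(P(u)) ≠ x(P(v))` (cell `b2b-bsdres`, CLASS-CLOSURE lane, class O10 — x1b GEN 33, class lead;
# file 23 of the local series — Silverman AEC VII.2.2 beyond `K = ℚ_p`, chord half)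

HONEST FRAMING (cell `b2b-bsdres`, run/shared/lean/b2b/bsd-rank1-residual/, verbatim in every
file): the goal of the cell is to DELETE the COMBINATION-SHAPED residual classes of the
Birch–Swinnerton-Dyer formula for ALL analytic-rank `≤ 1` elliptic curves over `ℚ` — "full BSD
formula for every rank `≤ 1` curve in class `C`" assembled STRICTLY from published theorems — so
that the rank-`≤ 1` remainder becomes exactly the CONSTRUCTION-SHAPED classes, which are TYPED
(missing-input `Prop`s), NOT attempted. This is not "finishing BSD". CLASS-CLOSURE lane: prove
what is provable now; shrink each hard class to its core with data; no claim beyond stated classes;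
research routes on CONSTRUCTION-SHAPED X12 / O10; census / instrument output = EVIDENCE / conjecture
items, NEVER a Literature fact; `RESIDUAL-MAP.md` marks change only by signed lines. THIS FILE:
TOOL DEFINITION + THEOREMS (one definition with body: `evF`, the value `F(u, v) ∈ 𝒪_K`; every
statement proved) — no named Literature fact, no Summits-side fact `def … : Prop`, no `sorry`,
axioms standard; nothing is booked; no label / mark / count / sub-cell moves; O10 stays OPEN /
CONSTRUCTION-SHAPED; nothing about `BSD(W, p)` of any pair is claimed.

## Content (`M/ℤ_p` with elliptic generic fibre, `K` a complete ultrametric normed field over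
## `ℚ_p`, `E = curveK p K M`, `P(t) = ptOf p K M t _`, `F = formalGroupLaw M`)

* §1 `evF u v` (`= F(u, v) ∈ 𝒪_K`), `‖F(u,v)‖ ≤ max ‖u‖ ‖v‖ < 1`; the evaluation dictionary for the
  two-variable identities (`coe_ev_X₀/₁`, `ev_subst_X₀/₁`, `ev_subst_formalGroupLaw`,
  `coe_ev₁_substPair`), `F(t, 0) = t`, `F(0, t) = t`, `F(t, i(t)) = 0` at points.
* §2 the chord identities of `FormalGroupLawChordFormulaProofs` evaluated at `(u, v)`
  (`chordX_at`, `chordY_at`) and **`ptOf_add_of_x_ne`: `P(u) + P(v) = P(F(u, v))` when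
  `x(P(u)) ≠ x(P(v))`** (field algebra `chart_chordX/Y` of `FormalGroupLaurentPoints`).

References: [SilvermanAEC2009] III.2.3, IV.1–IV.2, VII.2.2.
-/

noncomputable section

open scoped Classical Topology NNReal
open Filter PowerSeries

namespace Summit.BirchSwinnertonDyer.Rank1Residual.Additive

namespace BallEval

open Literature.NumberTheory.GaloisRepresentations.LubinTate (unitBall mem_unitBall_iff)
open Literature.NumberTheory.EllipticCurves Literature.NumberTheory.EllipticCurves.FormalGroupChart
open WeierstrassCurve

variable {p : ℕ} [hp : Fact p.Prime] {K : Type*} [NontriviallyNormedField K] [NormedAlgebra ℚ_[p] K]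
  [IsUltrametricDist K] [CompleteSpace K] {M : WeierstrassCurve ℤ_[p]}

/-! ## §1 `F(u, v)` and the evaluation dictionary -/

variable (p M) in
/-- **`F(u, v) ∈ 𝒪_K`**, the formal group law of `M` evaluated at a pair of points of the open disc.
[cite: SilvermanAEC2009, Prop. VII.2.2] -/
def evF (u v : unitBall K) (hu : ‖(u : K)‖ < 1) (hv : ‖(v : K)‖ < 1) : unitBall K :=
  ev p K ![u, v] (hasEval_pair hu hv) M.formalGroupLaw

/-- `‖F(u, v)‖ ≤ max ‖u‖ ‖v‖`. [folklore] -/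
theorem norm_evF_le {u v : unitBall K} (hu : ‖(u : K)‖ < 1) (hv : ‖(v : K)‖ < 1) :
    ‖(evF p M u v hu hv : K)‖ ≤ max ‖(u : K)‖ ‖(v : K)‖ := by
  have h := norm_ev_le_of_constantCoeff_eq_zero (hasEval_pair hu hv) M.constantCoeff_formalGroupLaw
  rw [evF]
  refine h.trans (Finset.sup'_le _ _ fun i _ => ?_)
  fin_cases i
  · exact le_max_left _ _
  · exact le_max_right _ _

/-- `‖F(u, v)‖ < 1`. [folklore] -/
theorem norm_evF_lt_one {u v : unitBall K} (hu : ‖(u : K)‖ < 1) (hv : ‖(v : K)‖ < 1) :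
    ‖(evF p M u v hu hv : K)‖ < 1 :=
  (norm_evF_le hu hv).trans_lt (max_lt hu hv)

/-- Dictionary: `ev (X 0) = u`. [folklore] -/
theorem coe_ev_X₀ {u v : unitBall K} (hu : ‖(u : K)‖ < 1) (hv : ‖(v : K)‖ < 1) :
    ((ev p K ![u, v] (hasEval_pair hu hv) (MvPowerSeries.X 0 : MvPowerSeries (Fin 2) ℤ_[p]) : unitBall K) : K)
      = u := by
  rw [ev_X]; rfl

/-- Dictionary: `ev (X 1) = v`. [folklore] -/
theorem coe_ev_X₁ {u v : unitBall K} (hu : ‖(u : K)‖ < 1) (hv : ‖(v : K)‖ < 1) :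
    ((ev p K ![u, v] (hasEval_pair hu hv) (MvPowerSeries.X 1 : MvPowerSeries (Fin 2) ℤ_[p]) : unitBall K) : K)
      = v := by
  rw [ev_X]; rfl

/-- Dictionary: `ev (C a) = a`. [folklore] -/
theorem coe_ev_C {u v : unitBall K} (hu : ‖(u : K)‖ < 1) (hv : ‖(v : K)‖ < 1) (a : ℤ_[p]) :
    ((ev p K ![u, v] (hasEval_pair hu hv) (MvPowerSeries.C a : MvPowerSeries (Fin 2) ℤ_[p]) : unitBall K) : K)
      = coeffHom p K a := by
  rw [ev_C]

/-- Dictionary (in `𝒪_K`): `ev (f(z₀)) = ev₁ u f` for a one-variable `f` read in the first variable. [folklore] -/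
theorem ev_subst_X₀ {u v : unitBall K} (hu : ‖(u : K)‖ < 1) (hv : ‖(v : K)‖ < 1) (f : ℤ_[p]⟦X⟧) :
    ev p K ![u, v] (hasEval_pair hu hv) (f.subst (MvPowerSeries.X 0 : MvPowerSeries (Fin 2) ℤ_[p])) =
      ev₁ p K u (hasEval_of_norm_lt_one hu) f := by
  apply Subtype.ext
  rw [ev_powerSeries_subst (PowerSeries.HasSubst.X 0), ev₁_apply, ev_X]
  rfl

/-- Dictionary (in `𝒪_K`): `ev (f(z₁)) = ev₁ v f`. [folklore] -/
theorem ev_subst_X₁ {u v : unitBall K} (hu : ‖(u : K)‖ < 1) (hv : ‖(v : K)‖ < 1) (f : ℤ_[p]⟦X⟧) :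
    ev p K ![u, v] (hasEval_pair hu hv) (f.subst (MvPowerSeries.X 1 : MvPowerSeries (Fin 2) ℤ_[p])) =
      ev₁ p K v (hasEval_of_norm_lt_one hv) f := by
  apply Subtype.ext
  rw [ev_powerSeries_subst (PowerSeries.HasSubst.X 1), ev₁_apply, ev_X]
  rfl

/-- Dictionary (in `𝒪_K`): `ev (f(F)) = ev₁ (F(u,v)) f`. [folklore] -/
theorem ev_subst_formalGroupLaw {u v : unitBall K} (hu : ‖(u : K)‖ < 1) (hv : ‖(v : K)‖ < 1) (f : ℤ_[p]⟦X⟧) :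
    ev p K ![u, v] (hasEval_pair hu hv) (f.subst M.formalGroupLaw) =
      ev₁ p K (evF p M u v hu hv) (hasEval_of_norm_lt_one (norm_evF_lt_one (p := p) (M := M) hu hv)) f := by
  apply Subtype.ext
  rw [ev_powerSeries_subst (PowerSeries.HasSubst.of_constantCoeff_zero M.constantCoeff_formalGroupLaw), ev₁_apply]
  rfl

omit [NormedAlgebra ℚ_[p] K] [CompleteSpace K] hp in
/-- A constant `Unit`-indexed family at a point of the open disc is evaluable. [folklore] -/
theorem hasEval_const {t : unitBall K} (ht : ‖(t : K)‖ < 1) : MvPowerSeries.HasEval (fun _ : Unit => t) :=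
  mvHasEval_of_norm_lt_one fun _ => ht

/-- `ev₁ t` is `ev` at the constant family. [folklore] -/
theorem ev_const_eq_ev₁ {t : unitBall K} (ht : ‖(t : K)‖ < 1) :
    ev p K (fun _ : Unit => t) (hasEval_const ht) = ev₁ p K t (hasEval_of_norm_lt_one ht) := by
  ext f : 1
  rw [ev_apply, ev₁_apply]; rfl

/-- **Dictionary for pairs substituted into `F`**: `(G(g, h))(t) = G(g(t), h(t))` for one-variable
`g, h` without constant term. [folklore] -/
theorem coe_ev₁_substPair {t : unitBall K} (ht : ‖(t : K)‖ < 1) {g h : ℤ_[p]⟦X⟧}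
    (hg : PowerSeries.constantCoeff g = 0) (hh : PowerSeries.constantCoeff h = 0)
    (hg' : ‖((ev₁ p K t (hasEval_of_norm_lt_one ht) g : unitBall K) : K)‖ < 1)
    (hh' : ‖((ev₁ p K t (hasEval_of_norm_lt_one ht) h : unitBall K) : K)‖ < 1)
    (G : MvPowerSeries (Fin 2) ℤ_[p]) :
    ((ev₁ p K t (hasEval_of_norm_lt_one ht) (MvPowerSeries.subst ![g, h] G) : unitBall K) : K) =
      ((ev p K ![ev₁ p K t (hasEval_of_norm_lt_one ht) g, ev₁ p K t (hasEval_of_norm_lt_one ht) h]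
        (hasEval_pair hg' hh') G : unitBall K) : K) := by
  have h := ev_subst (K := K) (hasSubst_pair hg hh) (hasEval_const ht) G
  rw [ev_const_eq_ev₁ (p := p) ht] at h
  rw [h, ev_apply]
  congr 2
  funext i
  fin_cases i <;> rfl

/-- **`F(t, 0) = t`** at points (the tree's `formalGroupLaw_subst_X_zero'` evaluated).
[cite: SilvermanAEC2009, IV.2] -/
theorem coe_evF_zero_right {t : unitBall K} (ht : ‖(t : K)‖ < 1) (h0 : ‖((0 : unitBall K) : K)‖ < 1) :
    (evF p M t 0 ht h0 : K) = t := by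
  have h := congrArg (fun f => ((ev₁ p K t (hasEval_of_norm_lt_one ht) f : unitBall K) : K))
    M.formalGroupLaw_subst_X_zero'
  simp only [ev₁_X] at h
  have hX' : ‖((ev₁ p K t (hasEval_of_norm_lt_one ht) PowerSeries.X : unitBall K) : K)‖ < 1 := by
    rw [ev₁_X]; exact ht
  have h0' : ‖((ev₁ p K t (hasEval_of_norm_lt_one ht) 0 : unitBall K) : K)‖ < 1 := by
    rw [map_zero]; exact h0
  rw [coe_ev₁_substPair ht PowerSeries.constantCoeff_X (map_zero _) hX' h0', ev_apply] at h
  rw [evF, ev_apply]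
  have e : (![t, 0] : Fin 2 → unitBall K) =
      ![ev₁ p K t (hasEval_of_norm_lt_one ht) PowerSeries.X, ev₁ p K t (hasEval_of_norm_lt_one ht) 0] := by
    funext i; fin_cases i <;> simp [ev₁_X]
  rw [e]; exact h

/-- **`F(0, t) = t`** at points (the tree's `formalGroupLaw_subst_zero` evaluated).
[cite: SilvermanAEC2009, IV.2] -/
theorem coe_evF_zero_left {t : unitBall K} (ht : ‖(t : K)‖ < 1) (h0 : ‖((0 : unitBall K) : K)‖ < 1) :
    (evF p M 0 t h0 ht : K) = t := by
  have hid : MvPowerSeries.subst ![(0 : ℤ_[p]⟦X⟧), PowerSeries.X] M.formalGroupLaw = PowerSeries.X :=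
    M.formalGroupLaw_subst_zero PowerSeries.HasSubst.X'
  have h := congrArg (fun f => ((ev₁ p K t (hasEval_of_norm_lt_one ht) f : unitBall K) : K)) hid
  simp only [ev₁_X] at h
  have hX' : ‖((ev₁ p K t (hasEval_of_norm_lt_one ht) PowerSeries.X : unitBall K) : K)‖ < 1 := by
    rw [ev₁_X]; exact ht
  have h0' : ‖((ev₁ p K t (hasEval_of_norm_lt_one ht) 0 : unitBall K) : K)‖ < 1 := by
    rw [map_zero]; exact h0
  rw [coe_ev₁_substPair ht (map_zero _) PowerSeries.constantCoeff_X h0' hX', ev_apply] at h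
  rw [evF, ev_apply]
  have e : (![0, t] : Fin 2 → unitBall K) =
      ![ev₁ p K t (hasEval_of_norm_lt_one ht) 0, ev₁ p K t (hasEval_of_norm_lt_one ht) PowerSeries.X] := by
    funext i; fin_cases i <;> simp [ev₁_X]
  rw [e]; exact h

/-- **`F(t, i(t)) = 0`** at points (the tree's `formalGroupLaw_subst_X_formalNeg'` evaluated).
[cite: SilvermanAEC2009, IV.2] -/
theorem coe_evF_formalNeg {t : unitBall K} (ht : ‖(t : K)‖ < 1) :
    (evF p M t (ev₁ p K t (hasEval_of_norm_lt_one ht) M.formalNeg) ht (norm_ev₁_formalNeg_lt_one ht) : K)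
      = 0 := by
  have h := congrArg (fun f => ((ev₁ p K t (hasEval_of_norm_lt_one ht) f : unitBall K) : K))
    M.formalGroupLaw_subst_X_formalNeg'
  simp only [map_zero, Subring.coe_zero] at h
  have hX' : ‖((ev₁ p K t (hasEval_of_norm_lt_one ht) PowerSeries.X : unitBall K) : K)‖ < 1 := by
    rw [ev₁_X]; exact ht
  rw [coe_ev₁_substPair ht PowerSeries.constantCoeff_X M.constantCoeff_formalNeg hX'
    (norm_ev₁_formalNeg_lt_one ht), ev_apply] at h
  rw [evF, ev_apply]
  have e : (![t, ev₁ p K t (hasEval_of_norm_lt_one ht) M.formalNeg] : Fin 2 → unitBall K) =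
      ![ev₁ p K t (hasEval_of_norm_lt_one ht) PowerSeries.X, ev₁ p K t (hasEval_of_norm_lt_one ht) M.formalNeg] := by
    funext i; fin_cases i <;> simp [ev₁_X]
  rw [e]; exact h

/-! ## §2 The chord case -/

variable [hE : (M.map PadicInt.Coe.ringHom).IsElliptic]

/-- **The chord identity for `x`, at `(u, v)`** (`formalXMulSq_formalGroupLaw_chord` evaluated).
[cite: SilvermanAEC2009, IV.1] -/
theorem chordX_at {u v : unitBall K} (hu : ‖(u : K)‖ < 1) (hv : ‖(v : K)‖ < 1) :
    evX p M (evF p M u v hu hv) (norm_evF_lt_one hu hv) *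
        (evX p M u hu * (v : K) ^ 2 - evX p M v hv * (u : K) ^ 2) ^ 2 * (u : K) ^ 2 * (v : K) ^ 2 =
      (evF p M u v hu hv : K) ^ 2 *
        ((evX p M v hv * (u : K) ^ 3 - evX p M u hu * (v : K) ^ 3) ^ 2 +
            (coeffHom p K M.a₁ : K) * (evX p M v hv * (u : K) ^ 3 - evX p M u hu * (v : K) ^ 3) *
              (evX p M u hu * (v : K) ^ 2 - evX p M v hv * (u : K) ^ 2) * (u : K) * (v : K) -
          ((coeffHom p K M.a₂ : K) * (u : K) ^ 2 * (v : K) ^ 2 + evX p M u hu * (v : K) ^ 2 +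
              evX p M v hv * (u : K) ^ 2) *
            (evX p M u hu * (v : K) ^ 2 - evX p M v hv * (u : K) ^ 2) ^ 2) := by
  have h := congrArg (ev p K ![u, v] (hasEval_pair hu hv)) M.formalXMulSq_formalGroupLaw_chord
  simp only [map_mul, map_pow, map_add, map_sub, ev_X, ev_C, Matrix.cons_val_zero, Matrix.cons_val_one] at h
  rw [ev_subst_X₀ hu hv M.formalXMulSq, ev_subst_X₁ hu hv M.formalXMulSq,
    ev_subst_formalGroupLaw hu hv M.formalXMulSq] at h
  have h' := congrArg Subtype.val h
  simp only [Subring.coe_mul, SubmonoidClass.coe_pow, Subring.coe_add, AddSubgroupClass.coe_sub] at h'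
  exact h'

/-- **The chord identity for `y`, at `(u, v)`** (`formalXMulSq_formalGroupLaw_chordY` evaluated).
[cite: SilvermanAEC2009, IV.1] -/
theorem chordY_at {u v : unitBall K} (hu : ‖(u : K)‖ < 1) (hv : ‖(v : K)‖ < 1) :
    (-evX p M (evF p M u v hu hv) (norm_evF_lt_one hu hv) +
          (coeffHom p K M.a₁ : K) * evX p M (evF p M u v hu hv) (norm_evF_lt_one hu hv) * (evF p M u v hu hv : K) +
          (coeffHom p K M.a₃ : K) * (evF p M u v hu hv : K) ^ 3) *
        (evX p M u hu * (v : K) ^ 2 - evX p M v hv * (u : K) ^ 2) * (u : K) ^ 3 * (v : K) =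
      -((evX p M v hv * (u : K) ^ 3 - evX p M u hu * (v : K) ^ 3) *
          (evX p M (evF p M u v hu hv) (norm_evF_lt_one hu hv) * (u : K) ^ 2 -
            evX p M u hu * (evF p M u v hu hv : K) ^ 2) * (evF p M u v hu hv : K)) +
        evX p M u hu * (evX p M u hu * (v : K) ^ 2 - evX p M v hv * (u : K) ^ 2) *
          (evF p M u v hu hv : K) ^ 3 * (v : K) := by
  have h := congrArg (ev p K ![u, v] (hasEval_pair hu hv)) M.formalXMulSq_formalGroupLaw_chordY
  simp only [map_mul, map_pow, map_add, map_sub, map_neg, ev_X, ev_C, Matrix.cons_val_zero,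
    Matrix.cons_val_one] at h
  rw [ev_subst_X₀ hu hv M.formalXMulSq, ev_subst_X₁ hu hv M.formalXMulSq,
    ev_subst_formalGroupLaw hu hv M.formalXMulSq] at h
  have h' := congrArg Subtype.val h
  simp only [Subring.coe_mul, SubmonoidClass.coe_pow, Subring.coe_add, AddSubgroupClass.coe_sub,
    NegMemClass.coe_neg] at h'
  exact h'

variable [hint : (curveK p K M).IsIntegral (NormedField.valuation (K := K)).integer]

omit hint in
/-- **`P(u) + P(v) = P(F(u, v))` when `x(P(u)) ≠ x(P(v))`** (the chord case; `u, v ≠ 0`).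
[cite: SilvermanAEC2009, Prop. VII.2.2] -/
theorem ptOf_add_of_x_ne {u v : unitBall K} (hu : ‖(u : K)‖ < 1) (hv : ‖(v : K)‖ < 1)
    (hu0 : (u : K) ≠ 0) (hv0 : (v : K) ≠ 0)
    (hx : evX p M u hu / (u : K) ^ 2 ≠ evX p M v hv / (v : K) ^ 2) :
    ptOf p K M u hu + ptOf p K M v hv = ptOf p K M (evF p M u v hu hv) (norm_evF_lt_one hu hv) := by
  have keyX := chordX_at (p := p) (M := M) hu hv
  have keyY := chordY_at (p := p) (M := M) hu hv
  set F : K := (evF p M u v hu hv : K) with hFdef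
  set X₀ : K := evX p M u hu
  set X₁ : K := evX p M v hv
  set XF : K := evX p M (evF p M u v hu hv) (norm_evF_lt_one hu hv)
  -- `F ≠ 0`
  have hxs : X₀ * (v : K) ^ 2 - X₁ * (u : K) ^ 2 ≠ 0 := by
    intro h0
    apply hx
    rw [div_eq_div_iff (pow_ne_zero 2 hu0) (pow_ne_zero 2 hv0)]
    linear_combination h0
  have hF0 : F ≠ 0 := by
    intro hF
    have hXF : XF = 1 := by
      have h1 := norm_evX_sub_one_le (p := p) (M := M) (norm_evF_lt_one (p := p) (M := M) hu hv)
      rw [← hFdef, hF, norm_zero] at h1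
      exact sub_eq_zero.mp (norm_le_zero_iff.mp h1)
    rw [hF, hXF] at keyX
    have : (X₀ * (v : K) ^ 2 - X₁ * (u : K) ^ 2) ^ 2 * (u : K) ^ 2 * (v : K) ^ 2 = 0 := by
      linear_combination keyX
    simp only [mul_eq_zero, pow_eq_zero_iff, ne_eq, OfNat.ofNat_ne_zero, not_false_eq_true] at this
    rcases this with (h | h) | h
    · exact hxs h
    · exact hu0 h
    · exact hv0 h
  rw [ptOf_of_ne_zero hu hu0, ptOf_of_ne_zero hv hv0, ptOf_of_ne_zero _ hF0, Affine.Point.add_of_X_ne hx]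
  simp only [Affine.Point.some.injEq]
  have hcX := chart_chordX hu0 hv0 hF0 keyX
  have hcY := chart_chordY hu0 hv0 hF0 keyY
  have haddX := chord_addX_mul (curveK p K M) (-X₀ / (u : K) ^ 3) (-X₁ / (v : K) ^ 3) hx
  have haddY := chord_addY_mul (curveK p K M) (-X₀ / (u : K) ^ 3) (-X₁ / (v : K) ^ 3) hx
  simp only [curveK, map_a₁, map_a₂, map_a₃, RingHom.coe_comp, Function.comp_apply, Subring.coe_subtype]
    at haddX haddY hcX hcY ⊢
  have hD : X₀ / (u : K) ^ 2 - X₁ / (v : K) ^ 2 ≠ 0 := sub_ne_zero.mpr hx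
  have hX3 := mul_right_cancel₀ (pow_ne_zero 2 hD) (haddX.trans hcX.symm)
  refine ⟨hX3, ?_⟩
  rw [hX3] at haddY
  have hY3 := mul_right_cancel₀ hD (haddY.trans hcY.symm)
  linear_combination hY3

end BallEval

end Summit.BirchSwinnertonDyer.Rank1Residual.Additive

end
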